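import Summits.BirchSwinnertonDyer.BirchSwinnertonDyer.Theses.ShaPrimaryTransfer

/-!
# BirchSwinnertonDyer / ShaPrimaryTransfer — the assembly needs only the WEAK transfer
# (door prime ⟹ admissible primes of a global minimal model)

Route `ShaPrimaryTransfer` (D-0145 LINE 2) files the transfer crux T = `FiniteShaComponentTransfer`
(stmt-BirchSwinnertonDyer-22356) SYMMETRICALLY: `t_p(E) = 0 → t_q(E) = 0` for ALL primes `p, q`
(`t_p(E) = corank_{ℤ_p} Ш(E)[p^∞] = W.shaCorank p`), and its header leaves open («NOT DECOMPOSED YET») whether T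
should be weakened to the direction the deciding theorem `closes` actually consumes. This file (prover seat
`bsd-line-spt-p1`, `--supports stmt-22356 --as helper`) settles that bookkeeping question in Lean:

* `WeakTransfer` is NOT declared as a new statement (no `def`); it appears only as the HYPOTHESIS `hTw` of
  `bsd_of_weakTransfer`: for every elliptic `W/ℚ` on a GLOBAL MINIMAL model, every prime `p₀` and every prime
  `q ≥ 5` of good ordinary reduction, `t_{p₀}(E) = 0 → t_q(E) = 0` — the door-to-admissible direction only.
* `bsd_of_weakTransfer` — `hTw → OneFiniteShaComponent → AnalyticRankLeSelmerCorank →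
  PadicOrderLeAnalyticRankAtOnePrime → KatoRankBound → BirchSwinnertonDyer`: the route's deciding theorem with
  T replaced by the weak transfer. Proof = the proof of `Theses.ShaPrimaryTransfer.closes` verbatim (kernel now:
  O gives `p₀` on the minimal model `C • W`, `hTw` moves `t_{p₀} = 0` to X3's prime `p`, which is admissible),
  including its transport of `rank E(ℚ)` and `ord_{s=1} L(E,s)` along `C` — adapted from `closes`, not imported
  from it (the kernel sits inside that proof).
* `weakTransfer_of_finiteShaComponentTransfer` — T implies the weak transfer (so `closes` factors through
  `bsd_of_weakTransfer`; recorded as an `example`).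

Consequence for the planner (numbers, not adjectives): the symmetric half of T («admissible ⟹ door», and
door-to-door between small/bad primes) is idle in the assembly; the load-bearing content is «`t_{p₀} = 0` at the
door ⟹ `t_q = 0` at ONE (indeed every) good ordinary `q ≥ 5`», whose open kernel is the same as T's (rank ≥ 2;
rank ≤ 1 with a door at 2, 3, a bad, supersingular or non-CM Eisenstein prime — companion file `…Sectors`).
Nothing here proves T, the weak transfer, O, X2, X3, the Kato side, or BSD.
-/

-- D-0017: single-problem summit, so `Summit.BirchSwinnertonDyer.BirchSwinnertonDyer.…` repeats a namespace BY DESIGN.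
set_option linter.dupNamespace false

noncomputable section

namespace Summit.BirchSwinnertonDyer.BirchSwinnertonDyer.Theorems.ShaPrimaryTransferWeakTransfer

open scoped Classical
open Literature
open Summit.BirchSwinnertonDyer.BirchSwinnertonDyer.Theses.ShaPrimaryTransfer

/-- **T implies the weak transfer** (specialisation of the symmetric statement to minimal models and
admissible target primes). [folklore] -/
theorem weakTransfer_of_finiteShaComponentTransfer (hT : FiniteShaComponentTransfer) :
    ∀ (W : WeierstrassCurve ℚ) [W.IsElliptic] [W.IsGloballyMinimal] (p₀ q : ℕ) [Fact p₀.Prime] [Fact q.Prime],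
      5 ≤ q → W.HasGoodReductionAtPrime q → ¬ (q : ℤ) ∣ W.frobeniusTrace q →
      W.shaCorank p₀ = 0 → W.shaCorank q = 0 :=
  fun W _ _ p₀ q _ _ _ _ _ h0 => hT W p₀ q h0

/-- **The assembly of route `ShaPrimaryTransfer` from the WEAK transfer.** Hypotheses: the weak transfer
`hTw` (door prime ⟹ every good ordinary `q ≥ 5`, on global minimal models), the door O, X2, X3 and the Kato
side (the route's items verbatim); conclusion: the summit statement. Proof adapted from the route's deciding
theorem `Theses.ShaPrimaryTransfer.closes` (planner-bsd-idea-4, 2026-08-27): KERNEL — on the global minimal model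
`C • W` (Néron, *AEC* VIII.8.3) at the prime `p` supplied by X3, O gives a door prime `p₀` with
`t_{p₀}(C • W) = 0` and `hTw` gives `t_p(C • W) = 0`; LEGS — Kummer identity `corank Sel_{p^∞} = rank + t_p`
(Greenberg LNM 1716 §1, tree theorem `selmerCorank_eq_mordellWeilRank_add_holds`) with X2 for `r_an ≤ r_MW`, X3
with Kato's bound for `r_MW ≤ r_an`; TRANSPORT — `rank E(ℚ)` (*AEC* III.3.1(b)) and `ord_{s=1} L(E,s)` (local
Euler factors are isomorphism invariants, *AEC* App. C §16) along `C`. [cite: Greenberg1999LNM, §1 pp. 54–57]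
[cite: Kato2004Asterisque, Thm. 17.4] [cite: SilvermanAEC2009, Cor. VIII.8.3 and App. C §16] -/
theorem bsd_of_weakTransfer
    (hTw : ∀ (W : WeierstrassCurve ℚ) [W.IsElliptic] [W.IsGloballyMinimal] (p₀ q : ℕ) [Fact p₀.Prime]
      [Fact q.Prime], 5 ≤ q → W.HasGoodReductionAtPrime q → ¬ (q : ℤ) ∣ W.frobeniusTrace q →
      W.shaCorank p₀ = 0 → W.shaCorank q = 0)
    (hO : OneFiniteShaComponent) (hX2 : AnalyticRankLeSelmerCorank) (hX3 : PadicOrderLeAnalyticRankAtOnePrime)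
    (hK : KatoRankBound) : _root_.BirchSwinnertonDyer := by
  -- (T1) the Mordell–Weil rank is an isomorphism invariant (AEC III.3.1(b); `VariableChangePoints`)
  have hMW : ∀ (W : WeierstrassCurve ℚ) (C : WeierstrassCurve.VariableChange ℚ),
      (C • W).mordellWeilRank = W.mordellWeilRank := fun W C =>
    @WeierstrassCurve.VariableChange.finrank_point_variableChange ℚ _ W C (Classical.decEq ℚ)
  -- (T2) the local Euler factor over the fraction field of a DVR is an isomorphism invariant
  have hloc : ∀ (R : Type) [CommRing R] [IsDomain R] [IsDiscreteValuationRing R]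
      (K : Type) [Field K] [Algebra R K] [IsFractionRing R K]
      (W : WeierstrassCurve K) [W.IsElliptic] (C : WeierstrassCurve.VariableChange K),
      (C • W).localEulerFactor R = W.localEulerFactor R := by
    intro R _ _ _ K _ _ _ W _ C
    obtain ⟨D, hD⟩ : ∃ D : WeierstrassCurve.VariableChange K,
        (C • W).minimal R = D • W.minimal R :=
      ⟨((C • W).exists_isMinimal R).choose * C * ((W.exists_isMinimal R).choose)⁻¹, by
        rw [WeierstrassCurve.minimal, WeierstrassCurve.minimal, mul_smul, mul_smul, inv_smul_smul]⟩
    haveI hE : (W.minimal R).IsElliptic := by rw [WeierstrassCurve.minimal]; infer_instance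
    have hΔ : (W.minimal R).Δ ≠ 0 := (W.minimal R).isUnit_Δ.ne_zero
    have hgood : ((C • W).minimal R).HasGoodReduction R ↔ (W.minimal R).HasGoodReduction R := by
      rw [WeierstrassCurve.hasGoodReduction_iff, WeierstrassCurve.hasGoodReduction_iff,
        WeierstrassCurve.valuation_Δ_eq_of_isMinimal_of_eq_smul R hD]
      exact and_congr_left' ⟨fun _ => inferInstance, fun _ => inferInstance⟩
    have hcard : Nat.card (((C • W).minimal R).reduction R).toAffine.Point =
        Nat.card ((W.minimal R).reduction R).toAffine.Point := by
      obtain ⟨E, hE⟩ := WeierstrassCurve.exists_reduction_eq_smul R hD hΔ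
      rw [hE]
      exact WeierstrassCurve.natCard_point_smul _ _
    have hpoly : (C • W).localPolynomial R = W.localPolynomial R := by
      classical
      unfold WeierstrassCurve.localPolynomial
      simp only [hgood, hcard,
        WeierstrassCurve.hasSplitMultiplicativeReduction_iff_of_isMinimal_of_eq_smul R hD hΔ,
        WeierstrassCurve.hasMultiplicativeReduction_iff_of_isMinimal_of_eq_smul R hD hΔ]
    simp only [WeierstrassCurve.localEulerFactor, WeierstrassCurve.localPowerSeries, hpoly]
  -- (T3) hence the analytic rank `ord_{s=1} L(E,s)` is an isomorphism invariant (AEC App. C §16)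
  have hAn : ∀ (W : WeierstrassCurve ℚ) [W.IsElliptic] (C : WeierstrassCurve.VariableChange ℚ),
      (C • W).analyticRank = W.analyticRank := by
    intro W _ C
    have hL : (C • W).LFunction = W.LFunction := by
      unfold WeierstrassCurve.LFunction
      congr 1
      funext v
      simp only [WeierstrassCurve.baseChange, ← WeierstrassCurve.map_variableChange]
      exact hloc _ _ _ _
    have hLS : (C • W).LSeries = W.LSeries := by
      funext s
      simp only [WeierstrassCurve.LSeries, hL]
    have hEC : (C • W).entireContinuations = W.entireContinuations := by
      simp only [WeierstrassCurve.entireContinuations, hLS]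
    have hEL : (C • W).entireLFunction = W.entireLFunction := by
      unfold WeierstrassCurve.entireLFunction
      rw [hEC, hLS]
    simp only [WeierstrassCurve.analyticRank, hEL]
  -- the two legs on a global minimal model `C • W` of an arbitrary elliptic `W`, at the prime of X3
  intro W hW
  obtain ⟨C, hC⟩ := WeierstrassCurve.hasGlobalMinimalModel_rat_holds W
  obtain ⟨p, hp, h5, hgood, hord, N, hN, f, hf, hle⟩ := hX3 (C • W)
  -- KERNEL (weak form): the door prime `p₀` of O on `C • W`, transferred to X3's admissible prime `p`
  have hsha : (C • W).shaCorank p = 0 := by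
    obtain ⟨p₀, hp₀, h0⟩ := hO (C • W)
    exact hTw (C • W) p₀ p h5 hgood hord h0
  -- leg 1 (lower bound r_an ≤ r_MW): kernel at p, the Kummer identity, X2 at p
  have hLB : (C • W).analyticRank ≤ (C • W).mordellWeilRank := by
    have hid : (C • W).selmerCorank p = (C • W).mordellWeilRank + (C • W).shaCorank p :=
      WeierstrassCurve.selmerCorank_eq_mordellWeilRank_add_holds (C • W) p
    have h2 := hX2 (C • W) p h5 hgood hord
    omega
  -- leg 2 (upper bound r_MW ≤ r_an): X3 at (p, f), the Kato side at (p, f)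
  have hUB : (C • W).mordellWeilRank ≤ (C • W).analyticRank := by
    have hp2 : p ≠ 2 := by omega
    have hordAt : Literature.NumberTheory.EllipticCurves.IsOrdinaryAt (C • W) p := ⟨hgood, hord⟩
    have hk := hK (C • W) p hp2 hordAt f hf
    exact_mod_cast hk.trans hle
  have h := le_antisymm hLB hUB
  rw [hAn W C, hMW W C] at h
  exact h

-- `closes` factors through the weak transfer: `closes hT = bsd_of_weakTransfer
-- (weakTransfer_of_finiteShaComponentTransfer hT)` as implications (not re-declared: it would restate `closes`).
example (hT : FiniteShaComponentTransfer) (hO : OneFiniteShaComponent) (hX2 : AnalyticRankLeSelmerCorank)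
    (hX3 : PadicOrderLeAnalyticRankAtOnePrime) (hK : KatoRankBound) : _root_.BirchSwinnertonDyer :=
  bsd_of_weakTransfer (weakTransfer_of_finiteShaComponentTransfer hT) hO hX2 hX3 hK

end Summit.BirchSwinnertonDyer.BirchSwinnertonDyer.Theorems.ShaPrimaryTransferWeakTransfer
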